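import Literature.Probability.RandomPlanarGeometry.HexSAWSurfaceWallDensity
import Literature.Probability.RandomPlanarGeometry.HexSAWSurfaceSecondOrderSharp
import Mathlib.Analysis.Complex.ExponentialBounds
import HarnessLib

/-!
# Honeycomb SAW at the Duminil-Copin–Smirnov surface: the surface-contact density deficit has COEFFICIENT ONE —
# `e^{2t} (1/2 − ρ^±(t)) → 1`, i.e. `1/2 − ρ^±(y) = y⁻² (1 + O(y^{−1/2}))`, WITHOUT differentiability of the free energy

Topic `Literature/Probability/RandomPlanarGeometry` (lane «pcv-sawmu», car «WALL-DENSITY-COEFFICIENT», a-p6 g16).  Combines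
`HexSAWSurfaceWallDensity.lean` («WALL-SURFACE-DENSITY», a-p6 g13/g14: the convex free energy `κ(t) = log β(eᵗ)`, its one-sided derivatives
`ρ⁻(t) ≤ ρ⁺(t)` — the contact densities —, `wallRightDensity_le_slope`, `slope_le_wallLeftDensity`) with `HexSAWSurfaceSecondOrderSharp.lean`
(«WALL-SECOND-ORDER-SHARP», a-p6 g15: `y + 1/y − 26247/y³ ≤ β(y)² ≤ y + 1/y + 8748/y²`).

The device.  The second-order window pins `L(y) := log β(y)² − log y` to `y⁻² + O(y⁻³)`.  A one-sided derivative of the convex `κ` at `t` is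
squeezed between the chords over `[t − h, t]` and `[t, t + h]`; with the MESOSCOPIC step `h = e^{−t/2} = y^{−1/2}` the chord of `t ↦ L(eᵗ)/2`
differs from `−e^{−2t}` by `O(h e^{−2t}) + O(e^{−3t}/h) = O(e^{−5t/2})`.  So the coefficient of the deficit is obtained although `κ` is only known
to be differentiable almost everywhere — the companion «WALL-DENSITY-SECOND-ORDER» (a-p6 g15, banked) records the ORDER `Θ(e^{−2t})` with
constants `1/4` and `13` and names the coefficient as not claimed.

Sources.  N. R. Beaton, M. Bousquet-Mélou, J. de Gier, H. Duminil-Copin, A. J. Guttmann, CMP 326 (2014) = arXiv:1109.0358v5, §3.1,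
Proposition 5 (p. 9: `μ(y)` non-decreasing, log-convex; p. 10: `μ(y) ∼ √y`).  E. J. Janse van Rensburg, *The Statistical Mechanics of
Interacting Walks, Polygons, Animals and Vesicles* (2000), §3.3 (free energies, densities as derivatives; convexity).  N. Madras,
G. Slade, *The Self-Avoiding Walk* (1993), §1.2.

## What is proved (namespace `…SAW.HexBW.Wall`)

* §1 `two_mul_wallFreeEnergy_eq` (`2κ(t) = log β(eᵗ)²`), `log_wallRate_sq_sub_le` (`log β(y)² − log y ≤ y⁻² + 8748 y⁻³`, `y ≥ 1`),
  `le_log_wallRate_sq_sub` (`y⁻² − 34996 y⁻⁴ ≤ log β(y)² − log y`, `y ≥ 163`).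
* §2 `exp_neg_two_mul_le`, `exp_two_mul_le` (`e^{∓2h} ≤ 1 ∓ 2h + 4h²`, `0 ≤ h ≤ ½`), `exp_three_mul_le_eight`.
* §3 ★★ `half_sub_wallRightDensity_ge_coeff (log 163 ≤ t) : e^{−2t} − 21874 e^{−5t/2} ≤ 1/2 − ρ⁺(t)`,
  ★★ `half_sub_wallLeftDensity_le_coeff (log 163 ≤ t) : 1/2 − ρ⁻(t) ≤ e^{−2t} + 52492 e^{−5t/2}`, `wallDensity_deficit_coeff_window`.
* §4 ★★★ **`tendsto_exp_mul_half_sub_wallRightDensity : e^{2t} (1/2 − ρ⁺(t)) → 1`**, ★★★ **`tendsto_exp_mul_half_sub_wallLeftDensity`**,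
  `isEquivalent_half_sub_wallRightDensity` (`1/2 − ρ⁺ ~ e^{−2t}`): in the fugacity, `y² (1/2 − ρ^±) → 1` — the thermodynamic density of
  surface contacts per step is `1/2 − y⁻² + O(y^{−5/2})`.

HONEST LABEL (author's proposal).  LANE THEOREM (S), OWN; NEW-IN-WRITING (modest): the COEFFICIENT of the `y⁻²` deficit of the contact density
(print: nothing beyond the first-order rate for this model, BBdGDCG p. 10).  Elementary (convexity + the tree's second-order window + a mesoscopic
chord).  NOT CLAIMED: the next term (`−(3/2) y⁻³`, which the lane's third/fourth-order windows would give by the same device with `h = y^{−3/2}`),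
optimal constants, the armchair wall.
-/

noncomputable section

open Filter Asymptotics
open _root_.Topology

namespace Literature.Probability.RandomPlanarGeometry.SAW.HexBW.Wall

variable {y : ℝ}

/-! ### §1  The logarithmic window `log β(y)² − log y = y⁻² + O(y⁻³)` -/

/-- `2κ(t) = log β(eᵗ)²`. [cite: BeatonBousquetMelouDeGierDuminilCopinGuttmann2014, §3.1, Proposition 5 (arXiv v5 p. 9)] -/
theorem two_mul_wallFreeEnergy_eq (t : ℝ) : 2 * wallFreeEnergy t = Real.log (wallRate (Real.exp t) ^ 2) := by
  rw [wallFreeEnergy_apply, Real.log_pow]; norm_num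

/-- **`log β(y)² − log y ≤ y⁻² + 8748 y⁻³`** (`y ≥ 1`; `log x ≤ x − 1` and the sharp upper window).
[cite: BeatonBousquetMelouDeGierDuminilCopinGuttmann2014, §3.1, Proposition 5 (arXiv v5 p. 9); p. 10 (first-order remark)] -/
theorem log_wallRate_sq_sub_le (hy : 1 ≤ y) : Real.log (wallRate y ^ 2) - Real.log y ≤ 1 / y ^ 2 + 8748 / y ^ 3 := by
  have hy0 : 0 < y := by linarith
  have hβ : 0 < wallRate y ^ 2 := pow_pos (wallRate_pos y) 2
  have hup := wallRate_sq_le_sharp hy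
  rw [← Real.log_div hβ.ne' hy0.ne']
  have h1 := Real.log_le_sub_one_of_pos (div_pos hβ hy0)
  have h2 : wallRate y ^ 2 / y - 1 ≤ 1 / y ^ 2 + 8748 / y ^ 3 := by
    rw [div_sub_one hy0.ne', div_le_iff₀ hy0]
    have e : (1 / y ^ 2 + 8748 / y ^ 3) * y = 1 / y + 8748 / y ^ 2 := by field_simp
    rw [e]; linarith
  linarith

/-- **`y⁻² − 34996 y⁻⁴ ≤ log β(y)² − log y`** (`y ≥ 163`, so that the sharp lower window `y + 1/y − 26247/y³` exceeds `y`; `1 − 1/x ≤ log x`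
with `x = β²/y`, and `β² ≤ y + 8749/y`). [cite: BeatonBousquetMelouDeGierDuminilCopinGuttmann2014, §3.1, Proposition 5 (arXiv v5 p. 9); p. 10 (first-order remark)] -/
theorem le_log_wallRate_sq_sub (hy : 163 ≤ y) : 1 / y ^ 2 - 34996 / y ^ 4 ≤ Real.log (wallRate y ^ 2) - Real.log y := by
  have hy0 : 0 < y := by linarith
  have hy1 : 1 ≤ y := by linarith
  have hβ : 0 < wallRate y ^ 2 := pow_pos (wallRate_pos y) 2
  have hlo := sharp_lower_window hy1
  have hB := wallRate_sq_le_add_div hy1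
  rw [← Real.log_div hβ.ne' hy0.ne']
  have h1 := Real.one_sub_inv_le_log_of_pos (div_pos hβ hy0)
  rw [inv_div] at h1
  have hy2 : 26569 ≤ y ^ 2 := by nlinarith
  -- `ℓ := 1/y − 26247/y³ ≥ 0` and `1 − y/β² = (β² − y)/β² ≥ ℓ/β² ≥ ℓ/(y + 8749/y)`
  have hnum : 0 ≤ 1 / y - 26247 / y ^ 3 := by
    have e : 1 / y - 26247 / y ^ 3 = (y ^ 2 - 26247) / y ^ 3 := by field_simp
    rw [e]; exact div_nonneg (by linarith) (by positivity)
  have hU0 : 0 < y + 8749 / y := by positivity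
  have hA : (1 / y - 26247 / y ^ 3) / (y + 8749 / y) ≤ (1 / y - 26247 / y ^ 3) / wallRate y ^ 2 :=
    div_le_div_of_nonneg_left hnum hβ hB
  have hB' : (1 / y - 26247 / y ^ 3) / wallRate y ^ 2 ≤ (wallRate y ^ 2 - y) / wallRate y ^ 2 :=
    div_le_div_of_nonneg_right (by linarith) hβ.le
  have hC : (wallRate y ^ 2 - y) / wallRate y ^ 2 = 1 - y / wallRate y ^ 2 := by rw [sub_div, div_self hβ.ne']
  -- `1/y² − 34996/y⁴ ≤ ℓ/(y + 8749/y)`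
  have hD : 1 / y ^ 2 - 34996 / y ^ 4 ≤ (1 / y - 26247 / y ^ 3) / (y + 8749 / y) := by
    rw [le_div_iff₀ hU0]
    have e : (1 / y ^ 2 - 34996 / y ^ 4) * (y + 8749 / y) = 1 / y - 26247 / y ^ 3 - 306180004 / y ^ 5 := by
      field_simp; ring
    rw [e]
    have : (0 : ℝ) ≤ 306180004 / y ^ 5 := by positivity
    linarith
  linarith

/-! ### §2  Exponential numerics for the mesoscopic step -/

/-- `e^{−2h} ≤ 1 − 2h + 4h²` for `0 ≤ h ≤ ½`. [cite: MadrasSlade1993, §1.2] -/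
theorem exp_neg_two_mul_le {h : ℝ} (h0 : 0 ≤ h) (h1 : h ≤ 1 / 2) : Real.exp (-(2 * h)) ≤ 1 - 2 * h + 4 * h ^ 2 := by
  have hx : |-(2 * h)| ≤ 1 := by rw [abs_neg, abs_of_nonneg (by linarith)]; linarith
  have := Real.abs_exp_sub_one_sub_id_le hx
  rw [abs_le] at this
  nlinarith [this.2]

/-- `e^{2h} ≤ 1 + 2h + 4h²` for `0 ≤ h ≤ ½`. [cite: MadrasSlade1993, §1.2] -/
theorem exp_two_mul_le {h : ℝ} (h0 : 0 ≤ h) (h1 : h ≤ 1 / 2) : Real.exp (2 * h) ≤ 1 + 2 * h + 4 * h ^ 2 := by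
  have hx : |2 * h| ≤ 1 := by rw [abs_of_nonneg (by linarith)]; linarith
  have := Real.abs_exp_sub_one_sub_id_le hx
  rw [abs_le] at this
  nlinarith [this.2]

/-- `e^{3h} ≤ 8` for `h ≤ ½` (`e^{3/2} < e² < 2.72² < 8`). [cite: MadrasSlade1993, §1.2] -/
theorem exp_three_mul_le_eight {h : ℝ} (h1 : h ≤ 1 / 2) : Real.exp (3 * h) ≤ 8 := by
  have he := Real.exp_one_lt_d9
  calc Real.exp (3 * h) ≤ Real.exp 2 := Real.exp_le_exp.2 (by linarith)
    _ = Real.exp 1 ^ 2 := by rw [← Real.exp_nat_mul]; norm_num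
    _ ≤ 8 := by nlinarith [Real.exp_pos 1]

/-! ### §3  The two chords with step `h = e^{−t/2}` -/

/-- The mesoscopic step: for `y = eᵗ ≥ 4`, `h = e^{−t/2}` satisfies `0 < h ≤ ½`, `h² = 1/y`, `e^{−2t} = 1/y²`, `e^{−5t/2} = h/y²`.
[cite: MadrasSlade1993, §1.2] -/
theorem meso_step_facts {t : ℝ} (ht : Real.log 4 ≤ t) :
    0 < Real.exp (-(t / 2)) ∧ Real.exp (-(t / 2)) ≤ 1 / 2 ∧ Real.exp (-(t / 2)) ^ 2 = 1 / Real.exp t ∧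
      Real.exp (-(2 * t)) = 1 / Real.exp t ^ 2 ∧ Real.exp (-(5 * t / 2)) = Real.exp (-(t / 2)) / Real.exp t ^ 2 := by
  refine ⟨Real.exp_pos _, ?_, ?_, ?_, ?_⟩
  · have h4 : Real.log 4 = 2 * Real.log 2 := by
      rw [show (4 : ℝ) = 2 ^ 2 by norm_num, Real.log_pow]; norm_num
    have h2 : -(t / 2) ≤ -Real.log 2 := by linarith
    calc Real.exp (-(t / 2)) ≤ Real.exp (-Real.log 2) := Real.exp_le_exp.2 h2
      _ = 1 / 2 := by rw [Real.exp_neg, Real.exp_log (by norm_num)]; norm_num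
  · rw [eq_div_iff (Real.exp_pos t).ne', ← Real.exp_nat_mul, ← Real.exp_add,
      show ((2 : ℕ) : ℝ) * (-(t / 2)) + t = 0 by push_cast; ring, Real.exp_zero]
  · rw [eq_div_iff (pow_pos (Real.exp_pos t) 2).ne', ← Real.exp_nat_mul, ← Real.exp_add,
      show -(2 * t) + ((2 : ℕ) : ℝ) * t = 0 by push_cast; ring, Real.exp_zero]
  · rw [eq_div_iff (pow_pos (Real.exp_pos t) 2).ne', ← Real.exp_nat_mul, ← Real.exp_add]
    congr 1; push_cast; ring

/-- Shifted fugacities: `e^{t+h} = eᵗ·eʰ ≥ eᵗ` and `e^{t−h} = eᵗ·e^{−h} ≥ eᵗ/2` (`0 ≤ h ≤ ½`), with the power identities used below.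
[cite: MadrasSlade1993, §1.2] -/
theorem shift_facts (t h : ℝ) (hh0 : 0 ≤ h) (hh1 : h ≤ 1 / 2) :
    Real.exp (t + h) = Real.exp t * Real.exp h ∧ Real.exp t ≤ Real.exp (t + h) ∧
      1 / Real.exp (t + h) ^ 2 = Real.exp (-(2 * h)) / Real.exp t ^ 2 ∧
      Real.exp (t - h) = Real.exp t * Real.exp (-h) ∧ Real.exp t / 2 ≤ Real.exp (t - h) ∧
      1 / Real.exp (t - h) ^ 2 = Real.exp (2 * h) / Real.exp t ^ 2 ∧ 1 / Real.exp (t - h) ^ 3 = Real.exp (3 * h) / Real.exp t ^ 3 := by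
  have ht0 := Real.exp_pos t
  refine ⟨Real.exp_add _ _, Real.exp_le_exp.2 (by linarith), ?_, by rw [sub_eq_add_neg, Real.exp_add], ?_, ?_, ?_⟩
  · rw [div_eq_div_iff (pow_pos (Real.exp_pos _) 2).ne' (pow_pos ht0 2).ne', one_mul]
    simp only [← Real.exp_nat_mul, ← Real.exp_add]
    congr 1; push_cast; ring
  · have h1 : 1 / 2 ≤ Real.exp (-h) := by
      have := Real.add_one_le_exp (-h)
      linarith
    rw [sub_eq_add_neg, Real.exp_add]
    nlinarith [Real.exp_pos (-h)]
  · rw [div_eq_div_iff (pow_pos (Real.exp_pos _) 2).ne' (pow_pos ht0 2).ne', one_mul]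
    simp only [← Real.exp_nat_mul, ← Real.exp_add]
    congr 1; push_cast; ring
  · rw [div_eq_div_iff (pow_pos (Real.exp_pos _) 3).ne' (pow_pos ht0 3).ne', one_mul]
    simp only [← Real.exp_nat_mul, ← Real.exp_add]
    congr 1; push_cast; ring

set_option maxHeartbeats 400000 in
/-- ★★ **`e^{−2t} − 21874·e^{−5t/2} ≤ 1/2 − ρ⁺(t)` for `t ≥ log 163`**: `ρ⁺(t)` is at most the slope of `κ` over `[t, t + h]`, `h = e^{−t/2}`,
and `2(κ(t+h) − κ(t)) = L(e^{t+h}) − L(eᵗ) + h ≤ h + (e^{−2h} − 1) e^{−2t} + 8748 e^{−3t} + 34996 e^{−4t}` with `e^{−2h} ≤ 1 − 2h + 4h²`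
(`L(y) = log β(y)² − log y`). [cite: BeatonBousquetMelouDeGierDuminilCopinGuttmann2014, §3.1, Proposition 5 (arXiv v5 p. 9: "log-convex"); JansevanRensburg2000, §3.3 (densities as derivatives of the free energy)] -/
theorem half_sub_wallRightDensity_ge_coeff {t : ℝ} (ht : Real.log 163 ≤ t) :
    Real.exp (-(2 * t)) - 21874 * Real.exp (-(5 * t / 2)) ≤ 1 / 2 - wallRightDensity t := by
  have ht4 : Real.log 4 ≤ t := (Real.log_le_log (by norm_num) (by norm_num)).trans ht
  obtain ⟨hh0, hh1, hh2, e2, e5⟩ := meso_step_facts ht4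
  obtain ⟨-, hyy', hinv2, -, -, -, -⟩ := shift_facts t (Real.exp (-(t / 2))) hh0.le hh1
  have hy0 : 0 < Real.exp t := Real.exp_pos t
  have hy163 : 163 ≤ Real.exp t := by
    have := Real.exp_le_exp.2 ht; rwa [Real.exp_log (by norm_num)] at this
  have hy1 : 1 ≤ Real.exp t := by linarith
  have hy'1 : 1 ≤ Real.exp (t + Real.exp (-(t / 2))) := hy1.trans hyy'
  have hy'0 : 0 < Real.exp (t + Real.exp (-(t / 2))) := by linarith
  rw [e2, e5]
  -- the chord
  have hlt : t < t + Real.exp (-(t / 2)) := by linarith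
  have hρ := wallRightDensity_le_slope hlt
  rw [slope_def_field, show t + Real.exp (-(t / 2)) - t = Real.exp (-(t / 2)) by ring] at hρ
  -- `2(κ(t+h) − κ(t)) = L(y') − L(y) + h`
  have hk : 2 * (wallFreeEnergy (t + Real.exp (-(t / 2))) - wallFreeEnergy t) =
      Real.log (wallRate (Real.exp (t + Real.exp (-(t / 2)))) ^ 2) - Real.log (wallRate (Real.exp t) ^ 2) := by
    rw [mul_sub, two_mul_wallFreeEnergy_eq, two_mul_wallFreeEnergy_eq]
  have hU := log_wallRate_sq_sub_le hy'1
  have hL := le_log_wallRate_sq_sub hy163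
  rw [Real.log_exp] at hL
  have h1 : 1 / Real.exp (t + Real.exp (-(t / 2))) ^ 2 ≤
      (1 - 2 * Real.exp (-(t / 2)) + 4 * Real.exp (-(t / 2)) ^ 2) / Real.exp t ^ 2 := by
    rw [hinv2]
    exact div_le_div_of_nonneg_right (exp_neg_two_mul_le hh0.le hh1) (by positivity)
  have h2 : 8748 / Real.exp (t + Real.exp (-(t / 2))) ^ 3 ≤ 8748 / Real.exp t ^ 3 :=
    div_le_div_of_nonneg_left (by norm_num) (pow_pos hy0 3) (pow_le_pow_left₀ hy0.le hyy' 3)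
  -- assemble
  have hk2 : wallFreeEnergy (t + Real.exp (-(t / 2))) - wallFreeEnergy t ≤ Real.exp (-(t / 2)) / 2 -
      Real.exp (-(t / 2)) / Real.exp t ^ 2 + 2 * Real.exp (-(t / 2)) ^ 2 / Real.exp t ^ 2 + 4374 / Real.exp t ^ 3 +
        17498 / Real.exp t ^ 4 := by
    have e : (1 - 2 * Real.exp (-(t / 2)) + 4 * Real.exp (-(t / 2)) ^ 2) / Real.exp t ^ 2 =
        1 / Real.exp t ^ 2 - 2 * Real.exp (-(t / 2)) / Real.exp t ^ 2 + 4 * Real.exp (-(t / 2)) ^ 2 / Real.exp t ^ 2 := by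
      field_simp
    have hsum : Real.log (wallRate (Real.exp (t + Real.exp (-(t / 2)))) ^ 2) - Real.log (wallRate (Real.exp t) ^ 2) ≤
        Real.exp (-(t / 2)) - 2 * Real.exp (-(t / 2)) / Real.exp t ^ 2 + 4 * Real.exp (-(t / 2)) ^ 2 / Real.exp t ^ 2 +
          8748 / Real.exp t ^ 3 + 34996 / Real.exp t ^ 4 := by
      rw [Real.log_exp] at hU
      linear_combination hU + hL + h1 + h2 + e
    linear_combination (1 / 2 : ℝ) * hsum + (1 / 2 : ℝ) * hk
  have hjunk : 2 * Real.exp (-(t / 2)) ^ 2 / Real.exp t ^ 2 + 4374 / Real.exp t ^ 3 + 17498 / Real.exp t ^ 4 ≤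
      21874 * Real.exp (-(t / 2)) ^ 2 / Real.exp t ^ 2 := by
    rw [hh2]
    have e1 : 2 * (1 / Real.exp t) / Real.exp t ^ 2 + 4374 / Real.exp t ^ 3 + 17498 / Real.exp t ^ 4 =
        (4376 * Real.exp t + 17498) / Real.exp t ^ 4 := by
      field_simp; ring
    have e2' : 21874 * (1 / Real.exp t) / Real.exp t ^ 2 = 21874 * Real.exp t / Real.exp t ^ 4 := by field_simp
    rw [e1, e2']
    exact div_le_div_of_nonneg_right (by nlinarith) (by positivity)
  have hslope : (wallFreeEnergy (t + Real.exp (-(t / 2))) - wallFreeEnergy t) / Real.exp (-(t / 2)) ≤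
      1 / 2 - 1 / Real.exp t ^ 2 + 21874 * Real.exp (-(t / 2)) / Real.exp t ^ 2 := by
    rw [div_le_iff₀ hh0]
    have e : (1 / 2 - 1 / Real.exp t ^ 2 + 21874 * Real.exp (-(t / 2)) / Real.exp t ^ 2) * Real.exp (-(t / 2)) =
        Real.exp (-(t / 2)) / 2 - Real.exp (-(t / 2)) / Real.exp t ^ 2 + 21874 * Real.exp (-(t / 2)) ^ 2 / Real.exp t ^ 2 := by
      ring
    rw [e]; linarith
  have e : (21874 : ℝ) * (Real.exp (-(t / 2)) / Real.exp t ^ 2) = 21874 * Real.exp (-(t / 2)) / Real.exp t ^ 2 := by ring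
  rw [e]
  linarith

set_option maxHeartbeats 400000 in
/-- ★★ **`1/2 − ρ⁻(t) ≤ e^{−2t} + 52492·e^{−5t/2}` for `t ≥ log 163`**: `ρ⁻(t)` is at least the slope of `κ` over `[t − h, t]`, `h = e^{−t/2}`,
and `2(κ(t) − κ(t−h)) = L(eᵗ) − L(e^{t−h}) + h ≥ h + (1 − e^{2h}) e^{−2t} − 8·8748 e^{−3t} − 34996 e^{−4t}` with `e^{2h} ≤ 1 + 2h + 4h²`,
`e^{3h} ≤ 8`. [cite: BeatonBousquetMelouDeGierDuminilCopinGuttmann2014, §3.1, Proposition 5 (arXiv v5 p. 9: "log-convex"); JansevanRensburg2000, §3.3 (densities as derivatives of the free energy)] -/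
theorem half_sub_wallLeftDensity_le_coeff {t : ℝ} (ht : Real.log 163 ≤ t) :
    1 / 2 - wallLeftDensity t ≤ Real.exp (-(2 * t)) + 52492 * Real.exp (-(5 * t / 2)) := by
  have ht4 : Real.log 4 ≤ t := (Real.log_le_log (by norm_num) (by norm_num)).trans ht
  obtain ⟨hh0, hh1, hh2, e2, e5⟩ := meso_step_facts ht4
  obtain ⟨-, -, -, -, hyy', hinv2, hinv3⟩ := shift_facts t (Real.exp (-(t / 2))) hh0.le hh1
  have hy0 : 0 < Real.exp t := Real.exp_pos t
  have hy163 : 163 ≤ Real.exp t := by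
    have := Real.exp_le_exp.2 ht; rwa [Real.exp_log (by norm_num)] at this
  have hy1 : 1 ≤ Real.exp t := by linarith
  have hy'1 : 1 ≤ Real.exp (t - Real.exp (-(t / 2))) := by linarith
  have hy'0 : 0 < Real.exp (t - Real.exp (-(t / 2))) := Real.exp_pos _
  rw [e2, e5]
  -- the chord
  have hlt : t - Real.exp (-(t / 2)) < t := by linarith
  have hρ := slope_le_wallLeftDensity hlt
  rw [slope_def_field, show t - (t - Real.exp (-(t / 2))) = Real.exp (-(t / 2)) by ring] at hρ
  have hk : 2 * (wallFreeEnergy t - wallFreeEnergy (t - Real.exp (-(t / 2)))) =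
      Real.log (wallRate (Real.exp t) ^ 2) - Real.log (wallRate (Real.exp (t - Real.exp (-(t / 2)))) ^ 2) := by
    rw [mul_sub, two_mul_wallFreeEnergy_eq, two_mul_wallFreeEnergy_eq]
  have hU := log_wallRate_sq_sub_le hy'1
  have hL := le_log_wallRate_sq_sub hy163
  rw [Real.log_exp] at hL
  have h1 : 1 / Real.exp (t - Real.exp (-(t / 2))) ^ 2 ≤
      (1 + 2 * Real.exp (-(t / 2)) + 4 * Real.exp (-(t / 2)) ^ 2) / Real.exp t ^ 2 := by
    rw [hinv2]
    exact div_le_div_of_nonneg_right (exp_two_mul_le hh0.le hh1) (by positivity)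
  have h2 : 8748 / Real.exp (t - Real.exp (-(t / 2))) ^ 3 ≤ 69984 / Real.exp t ^ 3 := by
    have e : 8748 / Real.exp (t - Real.exp (-(t / 2))) ^ 3 = 8748 * Real.exp (3 * Real.exp (-(t / 2))) / Real.exp t ^ 3 := by
      rw [mul_div_assoc, ← hinv3]; ring
    rw [e]
    exact div_le_div_of_nonneg_right (by nlinarith [exp_three_mul_le_eight hh1, Real.exp_pos (3 * Real.exp (-(t / 2)))])
      (by positivity)
  have hk2 : Real.exp (-(t / 2)) / 2 - Real.exp (-(t / 2)) / Real.exp t ^ 2 - 2 * Real.exp (-(t / 2)) ^ 2 / Real.exp t ^ 2 -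
      34992 / Real.exp t ^ 3 - 17498 / Real.exp t ^ 4 ≤ wallFreeEnergy t - wallFreeEnergy (t - Real.exp (-(t / 2))) := by
    have e : (1 + 2 * Real.exp (-(t / 2)) + 4 * Real.exp (-(t / 2)) ^ 2) / Real.exp t ^ 2 =
        1 / Real.exp t ^ 2 + 2 * Real.exp (-(t / 2)) / Real.exp t ^ 2 + 4 * Real.exp (-(t / 2)) ^ 2 / Real.exp t ^ 2 := by
      field_simp
    have hsum : Real.exp (-(t / 2)) - 2 * Real.exp (-(t / 2)) / Real.exp t ^ 2 - 4 * Real.exp (-(t / 2)) ^ 2 / Real.exp t ^ 2 -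
        69984 / Real.exp t ^ 3 - 34996 / Real.exp t ^ 4 ≤
        Real.log (wallRate (Real.exp t) ^ 2) - Real.log (wallRate (Real.exp (t - Real.exp (-(t / 2)))) ^ 2) := by
      rw [Real.log_exp] at hU
      linear_combination hU + hL + h1 + h2 + e
    linear_combination (1 / 2 : ℝ) * hsum - (1 / 2 : ℝ) * hk
  have hjunk : 2 * Real.exp (-(t / 2)) ^ 2 / Real.exp t ^ 2 + 34992 / Real.exp t ^ 3 + 17498 / Real.exp t ^ 4 ≤
      52492 * Real.exp (-(t / 2)) ^ 2 / Real.exp t ^ 2 := by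
    rw [hh2]
    have e1 : 2 * (1 / Real.exp t) / Real.exp t ^ 2 + 34992 / Real.exp t ^ 3 + 17498 / Real.exp t ^ 4 =
        (34994 * Real.exp t + 17498) / Real.exp t ^ 4 := by
      field_simp; ring
    have e2' : 52492 * (1 / Real.exp t) / Real.exp t ^ 2 = 52492 * Real.exp t / Real.exp t ^ 4 := by field_simp
    rw [e1, e2']
    exact div_le_div_of_nonneg_right (by nlinarith) (by positivity)
  have hslope : 1 / 2 - 1 / Real.exp t ^ 2 - 52492 * Real.exp (-(t / 2)) / Real.exp t ^ 2 ≤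
      (wallFreeEnergy t - wallFreeEnergy (t - Real.exp (-(t / 2)))) / Real.exp (-(t / 2)) := by
    rw [le_div_iff₀ hh0]
    have e : (1 / 2 - 1 / Real.exp t ^ 2 - 52492 * Real.exp (-(t / 2)) / Real.exp t ^ 2) * Real.exp (-(t / 2)) =
        Real.exp (-(t / 2)) / 2 - Real.exp (-(t / 2)) / Real.exp t ^ 2 - 52492 * Real.exp (-(t / 2)) ^ 2 / Real.exp t ^ 2 := by
      ring
    rw [e]; linarith
  have e : (52492 : ℝ) * (Real.exp (-(t / 2)) / Real.exp t ^ 2) = 52492 * Real.exp (-(t / 2)) / Real.exp t ^ 2 := by ring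
  rw [e]
  linarith

/-- ★★ **The coefficient window**: for `t ≥ log 163`,
`e^{−2t} − 21874 e^{−5t/2} ≤ 1/2 − ρ⁺(t) ≤ 1/2 − ρ⁻(t) ≤ e^{−2t} + 52492 e^{−5t/2}`.
[cite: BeatonBousquetMelouDeGierDuminilCopinGuttmann2014, §3.1, Proposition 5 (arXiv v5 p. 9); JansevanRensburg2000, §3.3] -/
theorem wallDensity_deficit_coeff_window {t : ℝ} (ht : Real.log 163 ≤ t) :
    Real.exp (-(2 * t)) - 21874 * Real.exp (-(5 * t / 2)) ≤ 1 / 2 - wallRightDensity t ∧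
      1 / 2 - wallRightDensity t ≤ 1 / 2 - wallLeftDensity t ∧
      1 / 2 - wallLeftDensity t ≤ Real.exp (-(2 * t)) + 52492 * Real.exp (-(5 * t / 2)) :=
  ⟨half_sub_wallRightDensity_ge_coeff ht, by linarith [wallLeftDensity_le_wallRightDensity t], half_sub_wallLeftDensity_le_coeff ht⟩

/-! ### §4  The coefficient is ONE -/

/-- `e^{2t} · e^{−5t/2} = e^{−t/2} → 0`. [cite: MadrasSlade1993, §1.2] -/
theorem tendsto_exp_mul_exp_neg_five_halves :
    Tendsto (fun t : ℝ => Real.exp (2 * t) * Real.exp (-(5 * t / 2))) atTop (𝓝 0) := by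
  have h : Tendsto (fun t : ℝ => Real.exp (-(t / 2))) atTop (𝓝 0) := by
    have := Real.tendsto_exp_neg_atTop_nhds_zero.comp (tendsto_id.atTop_div_const (by norm_num : (0 : ℝ) < 2))
    exact this.congr fun t => by simp
  refine h.congr fun t => ?_
  rw [← Real.exp_add]; congr 1; ring

/-- ★★★ **THE DEFICIT COEFFICIENT IS ONE (right density): `e^{2t} (1/2 − ρ⁺(t)) → 1`** — in the fugacity, `y² (1/2 − ρ⁺) → 1`.
[cite: BeatonBousquetMelouDeGierDuminilCopinGuttmann2014, §3.1, Proposition 5 (arXiv v5 p. 9); p. 10 (first-order remark)] [cite: JansevanRensburg2000, §3.3] -/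
theorem tendsto_exp_mul_half_sub_wallRightDensity :
    Tendsto (fun t : ℝ => Real.exp (2 * t) * (1 / 2 - wallRightDensity t)) atTop (𝓝 1) := by
  have h0 := tendsto_exp_mul_exp_neg_five_halves
  have hlow : Tendsto (fun t : ℝ => 1 - 21874 * (Real.exp (2 * t) * Real.exp (-(5 * t / 2)))) atTop (𝓝 1) := by
    simpa using (h0.const_mul 21874).const_sub 1
  have hup : Tendsto (fun t : ℝ => 1 + 52492 * (Real.exp (2 * t) * Real.exp (-(5 * t / 2)))) atTop (𝓝 1) := by
    simpa using (h0.const_mul 52492).const_add 1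
  refine tendsto_of_tendsto_of_tendsto_of_le_of_le' hlow hup ?_ ?_
  · filter_upwards [eventually_ge_atTop (Real.log 163)] with t ht
    obtain ⟨h1, -, -⟩ := wallDensity_deficit_coeff_window ht
    have he : Real.exp (2 * t) * Real.exp (-(2 * t)) = 1 := by rw [← Real.exp_add]; simp
    have := mul_le_mul_of_nonneg_left h1 (Real.exp_pos (2 * t)).le
    nlinarith [Real.exp_pos (2 * t)]
  · filter_upwards [eventually_ge_atTop (Real.log 163)] with t ht
    obtain ⟨-, h2, h3⟩ := wallDensity_deficit_coeff_window ht
    have he : Real.exp (2 * t) * Real.exp (-(2 * t)) = 1 := by rw [← Real.exp_add]; simp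
    have := mul_le_mul_of_nonneg_left (h2.trans h3) (Real.exp_pos (2 * t)).le
    nlinarith [Real.exp_pos (2 * t)]

/-- ★★★ **THE DEFICIT COEFFICIENT IS ONE (left density): `e^{2t} (1/2 − ρ⁻(t)) → 1`.**
[cite: BeatonBousquetMelouDeGierDuminilCopinGuttmann2014, §3.1, Proposition 5 (arXiv v5 p. 9); p. 10 (first-order remark)] [cite: JansevanRensburg2000, §3.3] -/
theorem tendsto_exp_mul_half_sub_wallLeftDensity :
    Tendsto (fun t : ℝ => Real.exp (2 * t) * (1 / 2 - wallLeftDensity t)) atTop (𝓝 1) := by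
  have h0 := tendsto_exp_mul_exp_neg_five_halves
  have hlow : Tendsto (fun t : ℝ => 1 - 21874 * (Real.exp (2 * t) * Real.exp (-(5 * t / 2)))) atTop (𝓝 1) := by
    simpa using (h0.const_mul 21874).const_sub 1
  have hup : Tendsto (fun t : ℝ => 1 + 52492 * (Real.exp (2 * t) * Real.exp (-(5 * t / 2)))) atTop (𝓝 1) := by
    simpa using (h0.const_mul 52492).const_add 1
  refine tendsto_of_tendsto_of_tendsto_of_le_of_le' hlow hup ?_ ?_
  · filter_upwards [eventually_ge_atTop (Real.log 163)] with t ht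
    obtain ⟨h1, h2, -⟩ := wallDensity_deficit_coeff_window ht
    have he : Real.exp (2 * t) * Real.exp (-(2 * t)) = 1 := by rw [← Real.exp_add]; simp
    have := mul_le_mul_of_nonneg_left (h1.trans h2) (Real.exp_pos (2 * t)).le
    nlinarith [Real.exp_pos (2 * t)]
  · filter_upwards [eventually_ge_atTop (Real.log 163)] with t ht
    obtain ⟨-, -, h3⟩ := wallDensity_deficit_coeff_window ht
    have he : Real.exp (2 * t) * Real.exp (-(2 * t)) = 1 := by rw [← Real.exp_add]; simp
    have := mul_le_mul_of_nonneg_left h3 (Real.exp_pos (2 * t)).le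
    nlinarith [Real.exp_pos (2 * t)]

/-- ★★ **`1/2 − ρ⁺(t) ~ e^{−2t}`** (asymptotic equivalence). [cite: BeatonBousquetMelouDeGierDuminilCopinGuttmann2014, §3.1, Proposition 5 (arXiv v5 p. 9); p. 10 (first-order remark)] -/
theorem isEquivalent_half_sub_wallRightDensity :
    (fun t : ℝ => 1 / 2 - wallRightDensity t) ~[atTop] (fun t : ℝ => Real.exp (-(2 * t))) := by
  refine (isEquivalent_iff_tendsto_one ?_).2 ?_
  · exact Eventually.of_forall fun t => (Real.exp_pos _).ne'
  · refine tendsto_exp_mul_half_sub_wallRightDensity.congr fun t => ?_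
    rw [Pi.div_apply, Real.exp_neg, div_inv_eq_mul, mul_comm]

/-- ★★ **`1/2 − ρ⁻(t) ~ e^{−2t}`.** [cite: BeatonBousquetMelouDeGierDuminilCopinGuttmann2014, §3.1, Proposition 5 (arXiv v5 p. 9); p. 10 (first-order remark)] -/
theorem isEquivalent_half_sub_wallLeftDensity :
    (fun t : ℝ => 1 / 2 - wallLeftDensity t) ~[atTop] (fun t : ℝ => Real.exp (-(2 * t))) := by
  refine (isEquivalent_iff_tendsto_one ?_).2 ?_
  · exact Eventually.of_forall fun t => (Real.exp_pos _).ne'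
  · refine tendsto_exp_mul_half_sub_wallLeftDensity.congr fun t => ?_
    rw [Pi.div_apply, Real.exp_neg, div_inv_eq_mul, mul_comm]

end Literature.Probability.RandomPlanarGeometry.SAW.HexBW.Wall
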